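import Summits.Ventures.HodgeRepro2.T5LocalDegreeBounds

/-!
# T5RamifiedPrimeToy — the prime `2` of `ℚ` RAMIFIES in `ℚ(ζ₄) = ℚ(i)`: `e = 2`, `f = 1`, and the
local degree formula gives `[ℚ(i)_{(1+i)} : ℚ_2] = 2`

Tier-5 kernel support (N3) — p8, gen 15.  §8(d): uses an L-value-free non-vanishing device: NO.

The ramified companion of `T5InertPrimeToy` (non-vacuity of the `(e, f) = (2, 1)` branch of
`T5LocalDegreeBounds.ramificationIdx'_inertiaDeg'_of_quadratic`): for `L` a fourth cyclotomic
extension of `ℚ`, `ζ := ζ₄`,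
* `toInteger_sq` — `ζ² = −1`; `two_eq_zeta_mul_sq` — `2 = ζ (ζ − 1)²`; `span_two_eq` — `(2) = (ζ − 1)²`;
* `wTwo` — the place `(ζ − 1)` of `L` (prime by Mathlib's `zeta_sub_one_prime_of_two_pow`),
  `vTwo` — the place `(2)` of `ℚ`; `map_vTwo_eq_sq` — `(2) 𝓞_L = (ζ − 1)²`;
* `ramificationIdx'_eq_two` — `e = 2` (`Ideal.ramificationIdx'_spec`); `inertiaDeg'_eq_one` —
  `f = 1` (`e f ≤ [L : ℚ] = 2`); **`finrank_adicCompletion_eq_two`** — `[L_{(ζ−1)} : ℚ_2] = 2`.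

Nothing here identifies which places of the datum ramify (the record's ramified places are p4's).
-/

namespace Summit.Ventures.HodgeRepro2.T5RamifiedPrimeToy

open NumberField IsDedekindDomain HeightOneSpectrum

variable (L : Type*) [Field L] [CharZero L] [IsCyclotomicExtension {2 ^ 2} ℚ L]

/-- `ζ₄² = −1` in `𝓞 L`. -/
theorem toInteger_sq :
    haveI : NumberField L := IsCyclotomicExtension.numberField {2 ^ 2} ℚ L
    ((IsCyclotomicExtension.zeta_spec (2 ^ 2) ℚ L).toInteger) ^ 2 = -1 := by
  haveI : NumberField L := IsCyclotomicExtension.numberField {2 ^ 2} ℚ L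
  have hζ := IsCyclotomicExtension.zeta_spec (2 ^ 2) ℚ L
  have h2 : IsPrimitiveRoot (hζ.toInteger ^ 2) 2 :=
    (hζ.toInteger_isPrimitiveRoot).pow (by norm_num) (by norm_num)
  exact h2.eq_neg_one_of_two_right

/-- `2 = ζ₄ (ζ₄ − 1)²` in `𝓞 L`. -/
theorem two_eq_zeta_mul_sq :
    haveI : NumberField L := IsCyclotomicExtension.numberField {2 ^ 2} ℚ L
    (2 : 𝓞 L) = (IsCyclotomicExtension.zeta_spec (2 ^ 2) ℚ L).toInteger *
      ((IsCyclotomicExtension.zeta_spec (2 ^ 2) ℚ L).toInteger - 1) ^ 2 := by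
  haveI : NumberField L := IsCyclotomicExtension.numberField {2 ^ 2} ℚ L
  have h := toInteger_sq L
  linear_combination (2 - (IsCyclotomicExtension.zeta_spec (2 ^ 2) ℚ L).toInteger) * h

/-- `ζ₄` is a unit of `𝓞 L`. -/
theorem isUnit_toInteger :
    haveI : NumberField L := IsCyclotomicExtension.numberField {2 ^ 2} ℚ L
    IsUnit (IsCyclotomicExtension.zeta_spec (2 ^ 2) ℚ L).toInteger := by
  haveI : NumberField L := IsCyclotomicExtension.numberField {2 ^ 2} ℚ L
  exact (IsCyclotomicExtension.zeta_spec (2 ^ 2) ℚ L).toInteger_isPrimitiveRoot.isUnit (by norm_num)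

/-- `ζ₄ − 1` is prime in `𝓞 L` (Mathlib). -/
theorem prime_toInteger_sub_one :
    haveI : NumberField L := IsCyclotomicExtension.numberField {2 ^ 2} ℚ L
    Prime ((IsCyclotomicExtension.zeta_spec (2 ^ 2) ℚ L).toInteger - 1) := by
  haveI : NumberField L := IsCyclotomicExtension.numberField {2 ^ 2} ℚ L
  exact IsPrimitiveRoot.zeta_sub_one_prime_of_two_pow (k := 1)
    (IsCyclotomicExtension.zeta_spec (2 ^ 2) ℚ L)

/-- `(2) = (ζ₄ − 1)²` as ideals of `𝓞 L`. -/
theorem span_two_eq :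
    haveI : NumberField L := IsCyclotomicExtension.numberField {2 ^ 2} ℚ L
    Ideal.span {(2 : 𝓞 L)} =
      Ideal.span {(IsCyclotomicExtension.zeta_spec (2 ^ 2) ℚ L).toInteger - 1} ^ 2 := by
  haveI : NumberField L := IsCyclotomicExtension.numberField {2 ^ 2} ℚ L
  rw [Ideal.span_singleton_pow, two_eq_zeta_mul_sq L, Ideal.span_singleton_mul_left_unit (isUnit_toInteger L)]

/-- `2` is prime in `𝓞 ℚ`. -/
theorem prime_two_ringOfIntegers_rat : Prime (2 : 𝓞 ℚ) :=
  (MulEquiv.prime_iff Rat.ringOfIntegersEquiv).1 (by rw [map_ofNat]; exact Int.prime_two)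

/-- The place `(2)` of `ℚ`. -/
noncomputable def vTwo : HeightOneSpectrum (𝓞 ℚ) where
  asIdeal := Ideal.span {(2 : 𝓞 ℚ)}
  isPrime := (Ideal.span_singleton_prime prime_two_ringOfIntegers_rat.ne_zero).2
    prime_two_ringOfIntegers_rat
  ne_bot := by simp [prime_two_ringOfIntegers_rat.ne_zero]

/-- `vTwo.asIdeal = (2)`. -/
theorem vTwo_asIdeal : vTwo.asIdeal = Ideal.span {(2 : 𝓞 ℚ)} := rfl

/-- The place `(ζ₄ − 1)` of `L` — the unique place above `2`. -/
noncomputable def wTwo :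
    haveI : NumberField L := IsCyclotomicExtension.numberField {2 ^ 2} ℚ L
    HeightOneSpectrum (𝓞 L) :=
  haveI : NumberField L := IsCyclotomicExtension.numberField {2 ^ 2} ℚ L
  { asIdeal := Ideal.span {(IsCyclotomicExtension.zeta_spec (2 ^ 2) ℚ L).toInteger - 1}
    isPrime := (Ideal.span_singleton_prime (prime_toInteger_sub_one L).ne_zero).2
      (prime_toInteger_sub_one L)
    ne_bot := by
      rw [Ne, Ideal.span_singleton_eq_bot]
      exact (prime_toInteger_sub_one L).ne_zero }

/-- `(wTwo L).asIdeal = (ζ₄ − 1)`. -/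
theorem wTwo_asIdeal :
    haveI : NumberField L := IsCyclotomicExtension.numberField {2 ^ 2} ℚ L
    (wTwo L).asIdeal = Ideal.span {(IsCyclotomicExtension.zeta_spec (2 ^ 2) ℚ L).toInteger - 1} :=
  rfl

/-- `(2) 𝓞_L = (ζ₄ − 1)²`: the place `2` ramifies. -/
theorem map_vTwo_eq_sq :
    haveI : NumberField L := IsCyclotomicExtension.numberField {2 ^ 2} ℚ L
    vTwo.asIdeal.map (algebraMap (𝓞 ℚ) (𝓞 L)) = (wTwo L).asIdeal ^ 2 := by
  haveI : NumberField L := IsCyclotomicExtension.numberField {2 ^ 2} ℚ L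
  rw [vTwo_asIdeal, wTwo_asIdeal, Ideal.map_span, Set.image_singleton, map_ofNat, span_two_eq L]

/-- `wTwo` lies over `vTwo`. -/
theorem liesOver :
    haveI : NumberField L := IsCyclotomicExtension.numberField {2 ^ 2} ℚ L
    (wTwo L).asIdeal.LiesOver vTwo.asIdeal := by
  haveI : NumberField L := IsCyclotomicExtension.numberField {2 ^ 2} ℚ L
  refine ⟨vTwo.isMaximal.eq_of_le (Ideal.comap_ne_top _ (wTwo L).isPrime.ne_top) ?_⟩
  refine Ideal.le_comap_of_map_le ?_
  rw [map_vTwo_eq_sq L]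
  exact Ideal.pow_le_self (by norm_num)

/-- `e((ζ₄ − 1)/2) = 2`. -/
theorem ramificationIdx'_eq_two :
    haveI : NumberField L := IsCyclotomicExtension.numberField {2 ^ 2} ℚ L
    vTwo.asIdeal.ramificationIdx' (wTwo L).asIdeal = 2 := by
  haveI : NumberField L := IsCyclotomicExtension.numberField {2 ^ 2} ℚ L
  refine Ideal.ramificationIdx'_spec (n := 2) (le_of_eq (map_vTwo_eq_sq L)) ?_
  rw [map_vTwo_eq_sq L]
  exact not_le_of_gt
    (Ideal.pow_right_strictAnti (wTwo L).asIdeal (wTwo L).ne_bot (wTwo L).isPrime.ne_top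
      (by norm_num : 2 < 2 + 1))

/-- `[L : ℚ] = 2`. -/
theorem finrank_eq_two : Module.finrank ℚ L = 2 := by
  rw [IsCyclotomicExtension.Rat.finrank (2 ^ 2) L]
  decide

/-- `f((ζ₄ − 1)/2) = 1`: from `e f ≤ [L : ℚ] = 2` with `e = 2` and `f ≠ 0`. -/
theorem inertiaDeg'_eq_one :
    haveI : NumberField L := IsCyclotomicExtension.numberField {2 ^ 2} ℚ L
    haveI := liesOver L
    vTwo.asIdeal.inertiaDeg' (wTwo L).asIdeal = 1 := by
  haveI : NumberField L := IsCyclotomicExtension.numberField {2 ^ 2} ℚ L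
  haveI := liesOver L
  have h := T5LocalDegreeBounds.ramificationIdx'_mul_inertiaDeg'_le_finrank vTwo (wTwo L)
  rw [ramificationIdx'_eq_two L, finrank_eq_two L] at h
  haveI : vTwo.asIdeal.IsMaximal := vTwo.isMaximal
  have hf := Ideal.inertiaDeg'_ne_zero vTwo.asIdeal (wTwo L).asIdeal
  omega

/-- **`[ℚ(i)_{(1+i)} : ℚ_2] = 2`** — the local degree formula at the ramified place `2`. -/
theorem finrank_adicCompletion_eq_two :
    haveI : NumberField L := IsCyclotomicExtension.numberField {2 ^ 2} ℚ L
    haveI := liesOver L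
    Module.finrank (vTwo.adicCompletion ℚ) ((wTwo L).adicCompletion L) = 2 := by
  haveI : NumberField L := IsCyclotomicExtension.numberField {2 ^ 2} ℚ L
  haveI := liesOver L
  rw [T5InertGlobalToLocal.finrank_adicCompletion_eq_mul vTwo (wTwo L), ramificationIdx'_eq_two L,
    inertiaDeg'_eq_one L]

/-- NON-VACUITY of the ramified branch `(e, f) = (2, 1)` of
`T5LocalDegreeBounds.ramificationIdx'_inertiaDeg'_of_quadratic`. -/
theorem ramified_branch_satisfiable :
    haveI : NumberField L := IsCyclotomicExtension.numberField {2 ^ 2} ℚ L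
    ∃ (v : HeightOneSpectrum (𝓞 ℚ)) (w : HeightOneSpectrum (𝓞 L)),
      w.asIdeal.LiesOver v.asIdeal ∧ v.asIdeal.ramificationIdx' w.asIdeal = 2 ∧
        v.asIdeal.inertiaDeg' w.asIdeal = 1 :=
  ⟨vTwo, wTwo L, liesOver L, ramificationIdx'_eq_two L, inertiaDeg'_eq_one L⟩

end Summit.Ventures.HodgeRepro2.T5RamifiedPrimeToy
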